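import Summits.AtomisticToContinuum.Crystallization.Theorems.PhononStability.Negative.InnerSites

/-!
# `PhononStability` (stmt-AtomisticToContinuum-9333), negative side IV: `Inner` is load-bearing

`PhononStabilityOn (fun _ A => Adm₀ A)` (the crux with the inner-shift hypothesis `Inner t A`
deleted, i.e. the window predicate `W t A = Adm A` of part I) is FALSE.  Witness (part III): cell `A₀ = 0.97·id`, translations `t = (0, δe₃)` (second
sublattice almost on top of the first), displacement `e₁·𝟙_{0}`.  The rows of the
second-variation double sum are `Σ H` (origin) and `H a` (label `a ≠` origin), with
`H(a) = e₁ᵀK(pos a)e₁`, so `hessForm = 2ΣH` (`hessForm_eq`); the far part of `ΣH` is bounded by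
the `δ`-FREE constant `M = Σ_{(m,l)} 904·2⁸‖l‖⁻⁸` (Mathlib `ZLattice.summable_norm_sub_inv_pow`)
and the near pair gives `V′(δ)/δ = −δ⁻¹⁴ + δ⁻⁸` (`tsum_H_le`); for `δ = min(1/4, 1/(M+1))` the
second variation is negative while the strain form is `≥ 0`
(`phononStability_false_without_Inner`).  So any proof of the crux must USE `Inner` (at least
to keep the two sublattices apart).  All `[folklore]`.
-/

noncomputable section

namespace Summit.AtomisticToContinuum.Crystallization.Theorems.PhononStabilityNegative

open scoped BigOperators Topology Classical InnerProductSpace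
open Filter Set Function
open Literature.MathematicalPhysics.StatisticalMechanics
open Summit.AtomisticToContinuum.Crystallization.Theses.ExcessDecayLiouville

local notation "E3" => EuclideanSpace ℝ (Fin 3)

/-! ### The displacement and the row structure of the second variation -/

/-- Transverse displacement `w = e₁`. [folklore] -/
def wV : E3 := EuclideanSpace.single 0 (1 : ℝ)
/-- Displacement field: `w` at the origin, `0` elsewhere. [folklore] -/
def uV : E3 → E3 := fun p => if p = 0 then wV else 0

/-- `‖e₁‖ = 1`. [folklore] -/
theorem norm_wV : ‖wV‖ = 1 := by rw [wV, PiLp.norm_single, norm_one]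

/-- `e₁ ⊥ δe₃`. [folklore] -/
theorem inner_dV_wV (δ : ℝ) : inner ℝ (dV δ) wV = 0 := by
  simp [dV, wV, EuclideanSpace.inner_single_left]

/-- `u` is supported in `{0}`. [folklore] -/
theorem support_uV : Function.support uV ⊆ {0} := by
  intro p hp; by_contra h; exact hp (if_neg h)

/-- The near pair: `wᵀK(δe₃)w = V′(δ)/δ = −δ⁻¹⁴ + δ⁻⁸`. [folklore] -/
theorem Hess₀_dV_wV {δ : ℝ} (h0 : 0 < δ) :
    Hess₀ (dV δ) wV = -(δ⁻¹) ^ 14 + (δ⁻¹) ^ 8 := by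
  rw [Hess₀_of_inner_eq_zero (inner_dV_wV δ), norm_dV h0.le, norm_wV,
    deriv_lennardJones h0.ne', div_eq_mul_inv]
  ring

/-! ### Row structure, majorant, and the value of the second variation -/

section Rows

variable {δ : ℝ}

/-- `L₀` is discrete (it is the `ℤ`-span of a basis). [folklore] -/
instance : DiscreteTopology L₀ := by unfold L₀ barlowPeriodLattice; infer_instance
/-- `L₀` is a full lattice (it is the `ℤ`-span of a basis). [folklore] -/
instance : IsZLattice ℝ L₀ := by unfold L₀ barlowPeriodLattice; infer_instance

/-- The row function: `H(a) = wᵀ K(pos a) w` off the origin, `0` at the origin. [folklore] -/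
def H (δ : ℝ) (a : Fin 2 × L₀) : ℝ := if a = o₀ then 0 else Hess₀ (pos δ a) wV

/-- The `δ`-free majorant `B(m, l) = 904·2⁸·‖l‖⁻⁸`. [folklore] -/
def B (a : Fin 2 × L₀) : ℝ := 231424 * (‖(a.2 : E3)‖⁻¹) ^ 8

/-- `B ≥ 0`. [folklore] -/
theorem B_nonneg (a : Fin 2 × L₀) : 0 ≤ B a := by unfold B; positivity

/-- `rank L₀ = 3`. [folklore] -/
theorem finrank_L₀ : Module.finrank ℤ L₀ = 3 := by
  rw [ZLattice.rank ℝ L₀, finrank_euclideanSpace, Fintype.card_fin]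

/-- `B` is summable over `Fin 2 × L₀` (`‖l‖⁻⁸` over a rank-3 lattice, Mathlib `ZLattice.summable_norm_sub_inv_pow`). [folklore] -/
theorem summable_B : Summable B := by
  have hs : Summable fun l : L₀ => ‖(l : E3) - 0‖⁻¹ ^ 8 :=
    ZLattice.summable_norm_sub_inv_pow L₀ 8 (by rw [finrank_L₀]; norm_num) 0
  simp only [sub_zero] at hs
  have h2 : ∀ m : Fin 2, Summable fun l : L₀ => B (m, l) := fun m => hs.mul_left 231424
  exact (summable_prod_of_nonneg fun a => B_nonneg a).2 ⟨h2, .of_finite⟩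

/-- The `δ`-free constant bounding the far field. [folklore] -/
def M : ℝ := ∑' a : Fin 2 × L₀, B a

/-- `M ≥ 0`. [folklore] -/
theorem M_nonneg : 0 ≤ M := tsum_nonneg B_nonneg

/-- Termwise domination `|H a| ≤ B a` off the near label `a₁` (far sites are at distance `≥ ‖l‖/2 ≥ … ≥ 1/2`). [folklore] -/
theorem abs_H_le_B (h0 : 0 < δ) (h1 : δ ≤ 1 / 4) {a : Fin 2 × L₀} (ha1 : a ≠ a₁) :
    |H δ a| ≤ B a := by
  unfold H
  split_ifs with ha
  · rw [abs_zero]; exact B_nonneg a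
  · obtain ⟨hge, hhalf⟩ := norm_pos_ge h0 h1 ha ha1
    have hl0 : 0 < ‖(a.2 : E3)‖ := norm_pos_iff.2 (snd_ne_zero_of_ne ha ha1)
    have hp0 : 0 < ‖pos δ a‖ := by linarith
    calc |Hess₀ (pos δ a) wV| ≤ 904 * (‖pos δ a‖⁻¹) ^ 8 := abs_Hess₀_le_inv_pow hhalf norm_wV
      _ ≤ 904 * ((‖(a.2 : E3)‖ / 2)⁻¹) ^ 8 := by
          gcongr
      _ = B a := by
          unfold B
          rw [inv_div, div_eq_mul_inv, mul_pow]
          ring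

/-- The far part of the row function. [folklore] -/
def H₂ (δ : ℝ) (a : Fin 2 × L₀) : ℝ := if a = a₁ then 0 else H δ a

/-- `|H₂| ≤ B` everywhere. [folklore] -/
theorem abs_H₂_le_B (h0 : 0 < δ) (h1 : δ ≤ 1 / 4) (a : Fin 2 × L₀) : |H₂ δ a| ≤ B a := by
  unfold H₂
  split_ifs with ha
  · rw [abs_zero]; exact B_nonneg a
  · exact abs_H_le_B h0 h1 ha

/-- The far part is summable. [folklore] -/
theorem summable_H₂ (h0 : 0 < δ) (h1 : δ ≤ 1 / 4) : Summable (H₂ δ) :=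
  Summable.of_norm_bounded summable_B fun a => by
    rw [Real.norm_eq_abs]; exact abs_H₂_le_B h0 h1 a

/-- The far part is bounded by the `δ`-free constant: `Σ H₂ ≤ M`. [folklore] -/
theorem tsum_H₂_le (h0 : 0 < δ) (h1 : δ ≤ 1 / 4) : ∑' a, H₂ δ a ≤ M :=
  Summable.tsum_le_tsum (fun a => (le_abs_self _).trans (abs_H₂_le_B h0 h1 a))
    (summable_H₂ h0 h1) summable_B

/-- `H = (near pair) + H₂`. [folklore] -/
theorem H_eq_add (a : Fin 2 × L₀) :
    H δ a = (if a = a₁ then Hess₀ (dV δ) wV else 0) + H₂ δ a := by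
  unfold H₂ H
  by_cases ha : a = a₁
  · subst ha
    simp [o₀_ne_a₁.symm]
  · simp [ha]

/-- The row function `H` is summable. [folklore] -/
theorem summable_H (h0 : 0 < δ) (h1 : δ ≤ 1 / 4) : Summable (H δ) := by
  have : H δ = fun a => (if a = a₁ then Hess₀ (dV δ) wV else 0) + H₂ δ a :=
    funext H_eq_add
  rw [this]
  exact (hasSum_ite_eq a₁ _).summable.add (summable_H₂ h0 h1)

/-- **The far field is bounded uniformly in `δ`:** `Σ H ≤ V′(δ)/δ + M`. [folklore] -/
theorem tsum_H_le (h0 : 0 < δ) (h1 : δ ≤ 1 / 4) :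
    ∑' a, H δ a ≤ -(δ⁻¹) ^ 14 + (δ⁻¹) ^ 8 + M := by
  have : H δ = fun a => (if a = a₁ then Hess₀ (dV δ) wV else 0) + H₂ δ a :=
    funext H_eq_add
  rw [this, ((hasSum_ite_eq a₁ _).summable).tsum_add (summable_H₂ h0 h1), tsum_ite_eq,
    Hess₀_dV_wV h0]
  linarith [tsum_H₂_le h0 h1]

/-- `u(pos b) = e₁` exactly at the origin label. [folklore] -/
theorem uV_pos (h0 : 0 < δ) (h1 : δ ≤ 1 / 4) (b : Fin 2 × L₀) :
    uV (pos δ b) = if b = o₀ then wV else 0 := by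
  unfold uV
  simp only [pos_eq_zero_iff h0 h1]

/-- **Row sums of the second variation**: the origin row is `Σ H`, every other row `a` is `H a`. [folklore] -/
theorem row_eq (h0 : 0 < δ) (h1 : δ ≤ 1 / 4) (a : Fin 2 × L₀) :
    (∑' b : Fin 2 × L₀, if pos δ a ≠ pos δ b then
        Hess₀ (pos δ a - pos δ b) (uV (pos δ a) - uV (pos δ b)) else 0) =
      if a = o₀ then ∑' b, H δ b else H δ a := by
  by_cases ha : a = o₀
  · subst ha
    rw [if_pos rfl]
    refine tsum_congr fun b => ?_
    by_cases hb : b = o₀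
    · subst hb; simp [H]
    · have hpb : pos δ b ≠ 0 := fun h => hb ((pos_eq_zero_iff h0 h1).1 h)
      rw [uV_pos h0 h1, uV_pos h0 h1, if_pos rfl, if_neg hb, pos_o₀, if_pos (Ne.symm hpb),
        zero_sub, sub_zero, Hess₀_neg_left]
      simp [H, hb]
  · rw [if_neg ha]
    have hpa : pos δ a ≠ 0 := fun h => ha ((pos_eq_zero_iff h0 h1).1 h)
    have hsum : (fun b : Fin 2 × L₀ => if pos δ a ≠ pos δ b then
        Hess₀ (pos δ a - pos δ b) (uV (pos δ a) - uV (pos δ b)) else 0) =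
        fun b => if b = o₀ then H δ a else 0 := by
      funext b
      rw [uV_pos h0 h1, uV_pos h0 h1, if_neg ha]
      by_cases hb : b = o₀
      · subst hb
        rw [if_pos rfl, if_pos rfl, pos_o₀, if_pos hpa, sub_zero, zero_sub, Hess₀_neg_right]
        simp [H, ha]
      · rw [if_neg hb, if_neg hb, sub_zero, Hess₀_zero_right, ite_self]
    rw [hsum, tsum_ite_eq]

/-- **The second variation of the witness is twice the row sum `Σ H`.** [folklore] -/
theorem hessForm_eq (h0 : 0 < δ) (h1 : δ ≤ 1 / 4) :
    hessForm (tV δ) A₀ uV = 2 * ∑' a, H δ a := by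
  unfold hessForm
  rw [sites₀_eq_points δ h0 h1, tsum_tsum_points_eq h0 h1
    (fun p q => if p ≠ q then Hess₀ (p - q) (uV p - uV q) else 0)]
  rw [show (fun a : Fin 2 × L₀ => ∑' b : Fin 2 × L₀, if pos δ a ≠ pos δ b then
        Hess₀ (pos δ a - pos δ b) (uV (pos δ a) - uV (pos δ b)) else 0) =
      fun a => H δ a + if a = o₀ then ∑' b, H δ b else 0 from ?_]
  · rw [(summable_H h0 h1).tsum_add (hasSum_ite_eq o₀ _).summable, tsum_ite_eq]
    ring
  · funext a
    rw [row_eq h0 h1 a]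
    by_cases ha : a = o₀
    · subst ha; simp [H]
    · simp [ha]

end Rows

/-! ### The refutation -/

/-- **`Inner` is load-bearing.** Without the inner-shift hypothesis the second sublattice may sit
at `δe₃` on top of the first (cell `A = 0.97·id` admissible); the transverse displacement `e₁`
at the origin then has second variation `2(V′(δ)/δ + far field)` with the far field bounded by
the `δ`-free lattice constant `M`, and `V′(δ)/δ = −δ⁻¹⁴ + δ⁻⁸ → −∞`: negative for
`δ = min(1/4, 1/(M+1))`, while the strain form is `≥ 0`. [folklore] -/
theorem phononStability_false_without_Inner : ¬ PhononStabilityOn fun _ A => Adm₀ A := by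
  intro hP
  unfold PhononStabilityOn at hP
  obtain ⟨κ, hκ, h⟩ := hP
  have hM := M_nonneg
  set δ : ℝ := min (1 / 4) (1 / (M + 1)) with hδ
  have h0 : 0 < δ := lt_min (by norm_num) (by positivity)
  have h1 : δ ≤ 1 / 4 := min_le_left _ _
  have h1' : δ ≤ 1 / (M + 1) := min_le_right _ _
  have hsupp : Function.support uV ⊆ Sites₀ (tV δ) A₀ := support_uV.trans (by
    intro p hp
    rw [Set.mem_singleton_iff] at hp
    subst hp
    exact ⟨0, 0, zero_mem_Λ₀, by simp⟩)
  have key := h (tV δ) A₀ adm₀_A₀ uV ((Set.finite_singleton (0 : E3)).subset support_uV) hsupp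
  rw [hessForm_eq h0 h1] at key
  have hH := tsum_H_le h0 h1
  have hnn := nnForm_nonneg (tV δ) A₀ uV
  have hx4 : (4 : ℝ) ≤ δ⁻¹ := by
    have := inv_anti₀ h0 h1; norm_num at this; exact this
  have hxM : M + 1 ≤ δ⁻¹ := by
    have := inv_anti₀ h0 h1'; rwa [one_div, inv_inv] at this
  have hx1 : (1 : ℝ) ≤ δ⁻¹ := by linarith
  have hx6 : (4096 : ℝ) ≤ (δ⁻¹) ^ 6 := by
    calc (4096 : ℝ) = 4 ^ 6 := by norm_num
      _ ≤ (δ⁻¹) ^ 6 := pow_le_pow_left₀ (by norm_num) hx4 6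
  have hx8 : M + 1 ≤ (δ⁻¹) ^ 8 := hxM.trans (le_self_pow₀ hx1 (by norm_num))
  have h14 : (δ⁻¹) ^ 14 = (δ⁻¹) ^ 8 * (δ⁻¹) ^ 6 := by ring
  have hA : (δ⁻¹) ^ 8 * 4096 ≤ (δ⁻¹) ^ 8 * (δ⁻¹) ^ 6 :=
    mul_le_mul_of_nonneg_left hx6 (by positivity)
  rw [h14] at hH
  have hκnn : 0 ≤ κ * nnForm (tV δ) A₀ uV := mul_nonneg hκ.le hnn
  linarith

end Summit.AtomisticToContinuum.Crystallization.Theorems.PhononStabilityNegative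

end
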